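import Summits.Ventures.HodgeRepro.DihedralQuadNoConj

/-!
# The dihedral rectangle — a sixth mechanism, for every finite `(G, c)`

Blind re-derivation cell `pub-hodge-repro`, seat `p1` (gen 11).  Route-2 g30's «Theorem A» (INBOX L1130; paper +
exhaustive enumeration: 24 instances per pointed `4`-set at `k = 3` on `D₁₂`, `C₄ × S₃`, `C₂ × C₂ × S₃`, 120 at
`k = 5` on `D₂₀` and `D₁₀ × C₂`) on the kernel:

**Theorem** (`exists_dihedralQuad`).  Let `s, t ∈ G` be involutions with `st` of order `2k`, `k ≥ 3` ODD, and
`(st)^k = c` the complex conjugation.  If `8k ≤ |G|` there is a CM type `Φ` whose twists `Φ, Φs, Φt, Φ(st)` are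
`SumTwo` without a conjugate pair.  (The class `D′` of ROUTE-B §9.36 — non-abelian Galois groups containing a
dihedral subgroup `D_{2k}` through `c` — now has a mechanism theorem beside the five abelian ones.)

Proof.  `s, t` generate a copy of Mathlib's `DihedralGroup (2k)` (`dihedralRectHom`: `r i ↦ (st)^i`, `sr i ↦ s (st)^i`,
multiplicative by `(st)^m s = s (ts)^m`; injective because `s ∉ ⟨st⟩` — a relation `s = (st)^a ((st)^b)⁻¹` would make
`s` commute with `st`, forcing `(st)² = 1`), and the generic construction `exists_quad_of_pattern` (CosetQuadCore.lean)
applies to the two local patterns of `DihedralQuadLocal.lean` — the CM condition, the local `SumTwo` and the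
absence of a common conjugate pair (`DihedralQuadNoConj.lean`) — with `|L| · |P| = 2 · 4k = 8k ≤ |G|`.
-/

set_option autoImplicit false

open Finset DihedralGroup
open scoped Pointwise

namespace HodgeRepro.CosetQuad

variable {G : Type*} [Group G]

/-! ### Involutions and their product -/

/-- `(st)^m s = s (ts)^m` (no hypothesis). -/
theorem pow_mul_left_eq (s t : G) (m : ℕ) : (s * t) ^ m * s = s * (t * s) ^ m := by
  induction m with
  | zero => rw [pow_zero, pow_zero, one_mul, mul_one]
  | succ n ih =>
    rw [pow_succ, mul_assoc, show s * t * s = s * (t * s) from mul_assoc _ _ _, ← mul_assoc, ih,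
      mul_assoc, ← pow_succ]

/-- For involutions, `ts = (st)⁻¹`. -/
theorem inv_mul_involutions {s t : G} (hs : s * s = 1) (ht : t * t = 1) : (s * t)⁻¹ = t * s := by
  rw [mul_inv_rev, inv_eq_of_mul_eq_one_right hs, inv_eq_of_mul_eq_one_right ht]

/-- `(st)^m s = s ((st)^m)⁻¹` for involutions. -/
theorem pow_mul_left_inv {s t : G} (hs : s * s = 1) (ht : t * t = 1) (m : ℕ) :
    (s * t) ^ m * s = s * ((s * t) ^ m)⁻¹ := by
  rw [pow_mul_left_eq, ← inv_mul_involutions hs ht, inv_pow]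

/-- `rmul Φ 1 = Φ`. -/
theorem rmul_one' [DecidableEq G] (Φ : Finset G) : rmul Φ 1 = Φ := by
  ext x; rw [mem_rmul, inv_one, mul_one]

section DihedralHom

variable (k : ℕ) [NeZero k]

/-- `2k ≠ 0`. -/
instance instNeZeroTwoMul : NeZero (2 * k) := ⟨by have := NeZero.ne k; omega⟩

/-- The power hom `ℤ/2k →* G`, `i ↦ (st)^i`, for `(st)^{2k} = 1`. -/
noncomputable def rotHom (s t : G) (hst : (s * t) ^ (2 * k) = 1) : Multiplicative (ZMod (2 * k)) →* G :=
  zmodPowHom (2 * k) (s * t) hst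

/-- `rotHom (ofAdd i) = (st)^{i.val}`. -/
theorem rotHom_apply (s t : G) (hst : (s * t) ^ (2 * k) = 1) (i : ZMod (2 * k)) :
    rotHom k s t hst (Multiplicative.ofAdd i) = (s * t) ^ i.val := rfl

/-- `ρ(i) s = s ρ(−i)` for involutions. -/
theorem rotHom_mul_left {s t : G} (hs : s * s = 1) (ht : t * t = 1) (hst : (s * t) ^ (2 * k) = 1)
    (i : ZMod (2 * k)) :
    rotHom k s t hst (Multiplicative.ofAdd i) * s = s * rotHom k s t hst (Multiplicative.ofAdd (-i)) := by
  rw [ofAdd_neg, map_inv, rotHom_apply, pow_mul_left_inv hs ht]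

/-- The underlying function of the dihedral hom: `r i ↦ (st)^i`, `sr i ↦ s (st)^i`. -/
noncomputable def dihedralRectFun (s t : G) (hst : (s * t) ^ (2 * k) = 1) : PD k → G
  | r i => rotHom k s t hst (Multiplicative.ofAdd i)
  | sr i => s * rotHom k s t hst (Multiplicative.ofAdd i)

/-- The dihedral hom `D_{2k} →* G` of two involutions whose product has `(st)^{2k} = 1`. -/
noncomputable def dihedralRectHom (s t : G) (hs : s * s = 1) (ht : t * t = 1) (hst : (s * t) ^ (2 * k) = 1) :
    PD k →* G :=
  MonoidHom.mk' (dihedralRectFun k s t hst) (by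
    rintro (i | i) (j | j)
    · show rotHom k s t hst (Multiplicative.ofAdd (i + j)) =
        rotHom k s t hst (Multiplicative.ofAdd i) * rotHom k s t hst (Multiplicative.ofAdd j)
      rw [ofAdd_add, map_mul]
    · show s * rotHom k s t hst (Multiplicative.ofAdd (j - i)) =
        rotHom k s t hst (Multiplicative.ofAdd i) * (s * rotHom k s t hst (Multiplicative.ofAdd j))
      rw [← mul_assoc, rotHom_mul_left k hs ht, mul_assoc, ← map_mul, ← ofAdd_add, sub_eq_neg_add]
    · show s * rotHom k s t hst (Multiplicative.ofAdd (i + j)) =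
        s * rotHom k s t hst (Multiplicative.ofAdd i) * rotHom k s t hst (Multiplicative.ofAdd j)
      rw [ofAdd_add, map_mul, mul_assoc]
    · show rotHom k s t hst (Multiplicative.ofAdd (j - i)) =
        s * rotHom k s t hst (Multiplicative.ofAdd i) * (s * rotHom k s t hst (Multiplicative.ofAdd j))
      rw [mul_assoc, ← mul_assoc _ s, rotHom_mul_left k hs ht, ← mul_assoc, ← mul_assoc, hs, one_mul,
        ← map_mul, ← ofAdd_add, sub_eq_neg_add])

/-- `dihedralRectHom (r i) = (st)^{i.val}`. -/
theorem dihedralRectHom_r (s t : G) (hs : s * s = 1) (ht : t * t = 1) (hst : (s * t) ^ (2 * k) = 1)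
    (i : ZMod (2 * k)) : dihedralRectHom k s t hs ht hst (r i) = (s * t) ^ i.val := rfl

/-- `dihedralRectHom (sr i) = s (st)^{i.val}`. -/
theorem dihedralRectHom_sr (s t : G) (hs : s * s = 1) (ht : t * t = 1) (hst : (s * t) ^ (2 * k) = 1)
    (i : ZMod (2 * k)) : dihedralRectHom k s t hs ht hst (sr i) = s * (s * t) ^ i.val := rfl

/-- `(st)^a = (st)^b` forces `a = b` in `ℤ/2k` when `st` has order `2k`. -/
theorem eq_of_pow_val_eq {s t : G} (hord : orderOf (s * t) = 2 * k) {i j : ZMod (2 * k)}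
    (h : (s * t) ^ i.val = (s * t) ^ j.val) : i = j := by
  have hmod := pow_eq_pow_iff_modEq.mp h
  rw [hord] at hmod
  apply ZMod.val_injective
  have := hmod
  rwa [Nat.ModEq, Nat.mod_eq_of_lt (ZMod.val_lt i), Nat.mod_eq_of_lt (ZMod.val_lt j)] at this

omit [NeZero k] in
/-- `s ∉ ⟨st⟩`: a relation `(st)^a = s (st)^b` forces `(st)² = 1`. -/
theorem not_pow_eq_mul_pow {s t : G} (hs : s * s = 1) (ht : t * t = 1) (hord : orderOf (s * t) = 2 * k)
    (hk : 3 ≤ k) (a b : ℕ) : (s * t) ^ a ≠ s * (s * t) ^ b := by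
  intro h
  set x := s * t with hx
  have hsdef : s = x ^ a * (x ^ b)⁻¹ := eq_mul_inv_of_mul_eq h.symm
  have hc' : Commute (x ^ a * (x ^ b)⁻¹) x :=
    ((Commute.refl x).pow_left a).mul_left ((Commute.refl x).pow_left b).inv_left
  have hcomm : s * x = x * s := by rw [hsdef]; exact hc'.eq
  rw [hx] at hcomm
  have e1 : t * s = s * t := by
    calc t * s = (s * (s * t)) * s := by rw [← mul_assoc, hs, one_mul]
      _ = (s * t * s) * s := by rw [hcomm]
      _ = s * t := by rw [mul_assoc, hs, mul_one]
  have h2 : (s * t) ^ 2 = 1 := by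
    calc (s * t) ^ 2 = s * (t * s) * t := by rw [pow_two]; group
      _ = s * (s * t) * t := by rw [e1]
      _ = 1 := by rw [← mul_assoc, hs, one_mul, ht]
  have hdvd : orderOf (s * t) ∣ 2 := orderOf_dvd_of_pow_eq_one h2
  rw [hord] at hdvd
  have := Nat.le_of_dvd (by norm_num) hdvd
  omega

/-- The dihedral hom is injective when `st` has order `2k`, `k ≥ 3`. -/
theorem dihedralRectHom_injective {s t : G} (hs : s * s = 1) (ht : t * t = 1) (hst : (s * t) ^ (2 * k) = 1)
    (hord : orderOf (s * t) = 2 * k) (hk : 3 ≤ k) : Function.Injective (dihedralRectHom k s t hs ht hst) := by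
  rintro (i | i) (j | j) h
  · rw [dihedralRectHom_r, dihedralRectHom_r] at h
    rw [eq_of_pow_val_eq k hord h]
  · rw [dihedralRectHom_r, dihedralRectHom_sr] at h
    exact absurd h (not_pow_eq_mul_pow k hs ht hord hk _ _)
  · rw [dihedralRectHom_sr, dihedralRectHom_r] at h
    exact absurd h.symm (not_pow_eq_mul_pow k hs ht hord hk _ _)
  · rw [dihedralRectHom_sr, dihedralRectHom_sr] at h
    rw [eq_of_pow_val_eq k hord (mul_left_cancel h)]

/-- `dihedralRectHom (conjD k) = (st)^k`. -/
theorem dihedralRectHom_conjD (s t : G) (hs : s * s = 1) (ht : t * t = 1) (hst : (s * t) ^ (2 * k) = 1) :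
    dihedralRectHom k s t hs ht hst (conjD k) = (s * t) ^ k := by
  rw [conjD, dihedralRectHom_r, val_K]

/-- The twists under the dihedral hom: `1, s, t, st`. -/
theorem dihedralRectHom_twistD (s t : G) (hs : s * s = 1) (ht : t * t = 1) (hst : (s * t) ^ (2 * k) = 1) :
    (dihedralRectHom k s t hs ht hst (twistD k 0) = 1) ∧ (dihedralRectHom k s t hs ht hst (twistD k 1) = s) ∧
    (dihedralRectHom k s t hs ht hst (twistD k 2) = t) ∧ (dihedralRectHom k s t hs ht hst (twistD k 3) = s * t) := by
  refine ⟨?_, ?_, ?_, ?_⟩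
  · show dihedralRectHom k s t hs ht hst (r 0) = 1
    rw [dihedralRectHom_r, ZMod.val_zero, pow_zero]
  · show dihedralRectHom k s t hs ht hst (sr 0) = s
    rw [dihedralRectHom_sr, ZMod.val_zero, pow_zero, mul_one]
  · show dihedralRectHom k s t hs ht hst (sr 1) = t
    rw [dihedralRectHom_sr, val_one', pow_one, ← mul_assoc, hs, one_mul]
  · show dihedralRectHom k s t hs ht hst (r 1) = s * t
    rw [dihedralRectHom_r, val_one', pow_one]

/-- `|D_{2k}| = 4k`. -/
theorem card_PD : Fintype.card (PD k) = 4 * k := by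
  rw [DihedralGroup.card]; ring

end DihedralHom

/-- **The dihedral rectangle.**  Involutions `s, t` with `st` of order `2k` (`k ≥ 3` odd) and `(st)^k = c`:
if `8k ≤ |G|` there is a CM type whose twists `Φ, Φs, Φt, Φ(st)` are `SumTwo` without a conjugate pair. -/
theorem exists_dihedralQuad [Fintype G] [DecidableEq G] {k : ℕ} {c : G} (hc : IsComplexConj c) {s t : G}
    (hs : s * s = 1) (ht : t * t = 1) (hord : orderOf (s * t) = 2 * k) (hk : 3 ≤ k) (hodd : Odd k)
    (hck : (s * t) ^ k = c) (hG : 8 * k ≤ Fintype.card G) :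
    ∃ Φ : Finset G, IsCMType c Φ ∧ SumTwo ![Φ, rmul Φ s, rmul Φ t, rmul Φ (s * t)] ∧
      ∀ i j : Fin 4, ![Φ, rmul Φ s, rmul Φ t, rmul Φ (s * t)] j ≠
        c • ![Φ, rmul Φ s, rmul Φ t, rmul Φ (s * t)] i := by
  haveI : NeZero k := ⟨by omega⟩
  have hpow : (s * t) ^ (2 * k) = 1 := by rw [← hord]; exact pow_orderOf_eq_one _
  have hψc : dihedralRectHom k s t hs ht hpow (conjD k) = c := by rw [dihedralRectHom_conjD, hck]
  have hcard : Fintype.card (Fin 2) * Fintype.card (PD k) ≤ Fintype.card G := by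
    rw [Fintype.card_fin, card_PD]; omega
  obtain ⟨Φ, hΦ, hs2, hnc⟩ := exists_quad_of_pattern (dihedralRectHom k s t hs ht hpow)
    (dihedralRectHom_injective k hs ht hpow hord hk) hc hψc (twistD k) (patternD k) (patternD_conj k hodd)
    (patternD_card k) (patternD_noConj k hk hodd) hcard
  obtain ⟨e0, e1, e2, e3⟩ := dihedralRectHom_twistD k s t hs ht hpow
  have hvec : (fun i => rmul Φ (dihedralRectHom k s t hs ht hpow (twistD k i))) =
      ![Φ, rmul Φ s, rmul Φ t, rmul Φ (s * t)] := by
    funext i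
    fin_cases i
    · show rmul Φ (dihedralRectHom k s t hs ht hpow (twistD k 0)) = Φ
      rw [e0, rmul_one']
    · show rmul Φ (dihedralRectHom k s t hs ht hpow (twistD k 1)) = rmul Φ s
      rw [e1]
    · show rmul Φ (dihedralRectHom k s t hs ht hpow (twistD k 2)) = rmul Φ t
      rw [e2]
    · show rmul Φ (dihedralRectHom k s t hs ht hpow (twistD k 3)) = rmul Φ (s * t)
      rw [e3]
  rw [hvec] at hs2
  refine ⟨Φ, hΦ, hs2, fun i j => ?_⟩
  rw [← hvec]
  exact hnc i j

end HodgeRepro.CosetQuad
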